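import Summits.QuantumFields.BalabanUV.T4Continuum.Support.NE7TensionEnergyDocked
import Summits.QuantumFields.BalabanUV.T4Continuum.Support.NE3ClassRadiusFamily
import Summits.QuantumFields.BalabanUV.T4Continuum.Support.NE3TopRadiusLetters
import HarnessLib

/-!
# NE7InteriorMinimiserDocking — (H∃)ᴱ FROM THE EXISTENCE OF INTERIOR MINIMISERS ALONE: the two `∀ j` smallness families of
# `NE7TensionEnergyDocked.hminE_of_interior` DISCHARGED from level-free closed-form `ε`-lines, non-emptiness and the `∀`-minimiser form of
# interiority (8) REPLACED by its existence form (8)∃ «at every level SOME constrained minimiser lies strictly inside the class»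

Cell `pub-balaban`, rung (B)+1 sub-cell t4, lineage `b2b-balaban-t4-ne7-p1`, generation 64 (CRUX PROVER NE7 #1, ruling e34b3e0c (2)); hunt (h7)
«ENERGY ROAD», steps (h7-viii) (smallness bookkeeping) and (h7-vi′) (the weakest interiority the road consumes).
§1 **`radSum_family_le`**, **`DSum_family_le`** — at the class radius `x_j = ε(L^{j+2})^{−2}` the tower letters are LEVEL-FREE: under `16·C₀·ε ≤ 3`
(`C₀ = 14464(d+1)²(d+4)²`, `L ≥ 2`) `radSum d L (j+1) x_j ≤ (8∕3)·ε∕L²`, `radIter d L (j+1) x_j ≤ 2ε∕L²` (`NE3ClassRadiusFamily.radIter_radSum_le_of_small`,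
top letter `(L²)^{j+1}·x_j = ε∕L²`) and `DSum d L (j+2) x_j ≤ 640(d+1)(d+4)·ε` (`NE3ExactLineSumsTower.DSum_le_top` + `loopRad` linear);
§2 **`hKS_of_line`**, **`hsmall_of_line`**, **`hls_of_lines`** — the three `∀ j` families of `hminE_of_interior` from the level-free lines
`16·K·ε ≤ 3·ρ·L²` (`K = 160064·d(d+1)(d+4)L³`, `ρ = √(L²∕L^d)`), `8√(3 card n)·(128(4d+5)(d+1)(d+4)·ε + (16∕3)·K·(ε∕L²)·√(L^d∕L²)) ≤ 1`,
`16·C₀·ε ≤ 3`, `2·twoLevelSmall d L·ε ≤ L²`;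
§3 **`hminE_of_interior_exists`** — (H∃)ᴱ `∀ V ∈ dom, ∀ k, ∃ U, IsMinimiser d (sfClass d L N ε) L N k V U ∧ Regular d L N ε g k U` from (8)∃
`∀ V ∈ dom, ∀ k, ∃ U, IsMinimiser … k V U ∧ ∃ a, 0 ≤ a < ε(L^k)^{−2} ∧ SmallField U a` and the lines ALONE (`L ≥ 2`, `N ≥ 1`, `0 ≤ ε ≤ 1∕50`): the
interior minimiser supplied by (8)∃ is the one whose tension `NE7TensionEnergyDocked.tension_energy_le_gprime` bounds (levels `≥ 2`; levels `≤ 1`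
trivially), so neither non-emptiness nor compactness nor the `∀`-minimiser interiority of p338339 is needed — (8)∃ is EXACTLY the shape of the existence
clause (8) of [Balaban1985Variational] Thm 1 in the dictionary (a minimal orbit of the big space lying in the small space), asserted for no datum;
§4 **`hminE_of_interior_exists_d4`** — `d = 4`: ONE numeric line `2·10⁹·√(card n)·L⁶·ε ≤ 1` implies every `ε`-line above.
HONEST FRAMING (page 1): re-assembly on a FIXED FINITE torus, rung (B)+1; (H∃)ᴱ CONDITIONAL on (8)∃ (B11 Theorem 1 type, NOT in the tree, NOT proved);
NE7, NE3 NOT PRINTED in [Balaban1984PropagatorsI]–[Balaban1989LargeFieldII] and NOT PROVED; continuum YM on T⁴ ⇐ BetaPertH ∧ nine spine estimates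
(0/9 proved); BetaPertH ⇐ (D1) ∧ (D4) ∧ CAP+tail; G-an2-4 gates asym, D1 and NE2/3/4; NOT infinite volume, NOT mass gap, NOT Clay.  0 def, 0 sorry.
-/

set_option autoImplicit false

open scoped BigOperators Matrix Matrix.Norms.L2Operator
open Finset

namespace Summit.QuantumFields.BalabanUV.T4Continuum.NE7InteriorMinimiserDocking

open Literature.MathematicalPhysics.QuantumFieldTheory.Balaban1983to89
open B7Prop1Explicit B7Prop2Explicit MatrixNorms UnitaryModel
open T4AveragingDeficitWall (IsUnitaryCfg SmallField flux)
open T4AveragingDeficitWallBoundary (periodBox IsPeriodicCfg)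
open AveragingDeficitTwoLevelPrep (twoLevelSmall prop1Radius)
open AveragingDeficitMultiLevelPrep (LevelSmall radIter prop1Radius_nonneg)
open ReplicationRightInverseBound (radSum radSum_nonneg)
open SpreadLift (loopRad)
open MinimalActionSandwich (IsMinimiser admissible)
open MinimalActionRate (Regular sfClass)
open NE3CovariantCalculus (cDstar)
open NE3HilbertSchmidtTorus
open NE3CovariantLineSumsL2Tower (rho rho_nonneg)
open NE3ExactLineSumsTower (DSum DSum_nonneg DSum_le_top)
open NE3ClassRadiusFamily (radIter_radSum_le_of_small levelSmall_family)
open NE3TopRadiusLetters (radIter_eq_iterate)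
open NE7FluxGradientFromTension (exists_fluxForm)
open NE7TensionEnergyDocked (tension_energy_le_gprime tension_energy_le_low)
open NE7EtaBackgroundTensionClass (hminE_of_tension)

noncomputable section

variable {d : ℕ}

/-! ## §1 The tower letters at the class radius are level-free -/

/-- The top letter of the class-radius family: `(L²)^{j+1}·ε(L^{j+2})^{−2} = ε∕L²`. [folklore] -/
theorem top_letter_eq {L : ℕ} (hL : 1 ≤ L) (ε : ℝ) (j : ℕ) :
    ((L : ℝ) ^ 2) ^ (j + 1) * (ε / ((L : ℝ) ^ (j + 2)) ^ 2) = ε / (L : ℝ) ^ 2 := by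
  have hL0 : (0 : ℝ) < L := by exact_mod_cast (show 0 < L by omega)
  have hne : ((L : ℝ) ^ (j + 2)) ^ 2 ≠ 0 := by positivity
  have hne2 : (L : ℝ) ^ 2 ≠ 0 := by positivity
  field_simp
  ring

/-- **THE RADII AT THE CLASS RADIUS** (`L ≥ 2`, `0 ≤ ε`, `16·C₀·ε ≤ 3`): `radSum d L (j+1) (ε(L^{j+2})^{−2}) ≤ (8∕3)·ε∕L²` and
`radIter d L (j+1) (ε(L^{j+2})^{−2}) ≤ 2·ε∕L²` — the k-free bootstrap `NE3ClassRadiusFamily.radIter_radSum_le_of_small` at the top letter `ε∕L²`.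
[folklore] -/
theorem radSum_family_le {L : ℕ} (hL : 2 ≤ L) {ε : ℝ} (hε : 0 ≤ ε) (hε1 : 16 * C0 d * ε ≤ 3) (j : ℕ) :
    radSum d L (j + 1) (ε / ((L : ℝ) ^ (j + 2)) ^ 2) ≤ 8 / 3 * (ε / (L : ℝ) ^ 2) ∧
      radIter d L (j + 1) (ε / ((L : ℝ) ^ (j + 2)) ^ 2) ≤ 2 * (ε / (L : ℝ) ^ 2) := by
  have hL1 : 1 ≤ L := le_trans (by norm_num) hL
  have hL0 : (0 : ℝ) < L := by exact_mod_cast (show 0 < L by omega)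
  have hx : 0 ≤ ε / ((L : ℝ) ^ (j + 2)) ^ 2 := by positivity
  have hC : C0 d = 14464 * ((d : ℝ) + 1) ^ 2 * ((d : ℝ) + 4) ^ 2 := by unfold C0; ring
  have h' : 14464 * ((d : ℝ) + 1) ^ 2 * ((d : ℝ) + 4) ^ 2 * (L : ℝ) ^ 2
      * (8 / 3 * (((L : ℝ) ^ 2) ^ (j + 1) * (ε / ((L : ℝ) ^ (j + 2)) ^ 2))) ≤ 1 / 2 := by
    rw [top_letter_eq hL1]
    have e : 14464 * ((d : ℝ) + 1) ^ 2 * ((d : ℝ) + 4) ^ 2 * (L : ℝ) ^ 2 * (8 / 3 * (ε / (L : ℝ) ^ 2))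
        = 8 / 3 * (14464 * ((d : ℝ) + 1) ^ 2 * ((d : ℝ) + 4) ^ 2) * ε := by
      field_simp
    rw [e, ← hC]
    linarith
  obtain ⟨hI, hS⟩ := radIter_radSum_le_of_small (d := d) hL (j + 1) hx h'
  rw [top_letter_eq hL1] at hI hS
  exact ⟨hS, hI⟩

/-- **THE ACCUMULATED DEFECT AT THE CLASS RADIUS** (`L ≥ 2`, `0 ≤ ε`, `16·C₀·ε ≤ 3`): `DSum d L (j+2) (ε(L^{j+2})^{−2}) ≤ 640(d+1)(d+4)·ε`
(`DSum_le_top`: twice the top defect weight `10·loopRad d L (radIter d L (j+1) x_j)`, and `loopRad d L y = 16(d+1)(d+4)L²·y` with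
`radIter ≤ 2ε∕L²`). [folklore] -/
theorem DSum_family_le {L : ℕ} (hL : 2 ≤ L) {ε : ℝ} (hε : 0 ≤ ε) (hε1 : 16 * C0 d * ε ≤ 3) (j : ℕ) :
    DSum d L (j + 2) (ε / ((L : ℝ) ^ (j + 2)) ^ 2) ≤ 640 * ((d : ℝ) + 1) * ((d : ℝ) + 4) * ε := by
  have hL0 : (0 : ℝ) < L := by exact_mod_cast (show 0 < L by omega)
  have hx : 0 ≤ ε / ((L : ℝ) ^ (j + 2)) ^ 2 := by positivity
  have h1 := DSum_le_top (d := d) hL (j + 1) hx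
  have hI := (radSum_family_le hL hε hε1 j).2
  rw [radIter_eq_iterate] at hI
  have hbot : 0 ≤ (L : ℝ) ^ (j + 1) * (10 * loopRad d L (ε / ((L : ℝ) ^ (j + 2)) ^ 2)) := by
    unfold loopRad; positivity
  have htop : loopRad d L ((prop1Radius d L)^[j + 1] (ε / ((L : ℝ) ^ (j + 2)) ^ 2)) ≤ 32 * ((d : ℝ) + 1) * ((d : ℝ) + 4) * ε := by
    have h0 : 0 ≤ 2 * (8 * ((d : ℝ) + 1) * ((d : ℝ) + 4) * (L : ℝ) ^ 2) := by positivity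
    calc loopRad d L ((prop1Radius d L)^[j + 1] (ε / ((L : ℝ) ^ (j + 2)) ^ 2))
        = 2 * (8 * ((d : ℝ) + 1) * ((d : ℝ) + 4) * (L : ℝ) ^ 2) * ((prop1Radius d L)^[j + 1] (ε / ((L : ℝ) ^ (j + 2)) ^ 2)) := by
          unfold loopRad; ring
      _ ≤ 2 * (8 * ((d : ℝ) + 1) * ((d : ℝ) + 4) * (L : ℝ) ^ 2) * (2 * (ε / (L : ℝ) ^ 2)) := mul_le_mul_of_nonneg_left hI h0
      _ = 32 * ((d : ℝ) + 1) * ((d : ℝ) + 4) * ε := by field_simp; ring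
  linarith

/-! ## §2 The three `∀ j` families from level-free lines -/

/-- **`hKS` FROM ONE LINE**: `16·K·ε ≤ 3·ρ·L²` (`K = 160064·d(d+1)(d+4)L³`, `ρ = rho d L = √(L²∕L^d)`) gives, for every `j`,
`K·radSum d L (j+1) (ε(L^{j+2})^{−2}) ≤ ρ∕2`. [folklore] -/
theorem hKS_of_line {L : ℕ} (hL : 2 ≤ L) {ε : ℝ} (hε : 0 ≤ ε) (hε1 : 16 * C0 d * ε ≤ 3)
    (hK : 16 * (160064 * (d : ℝ) * (d + 1) * (d + 4) * (L : ℝ) ^ 3) * ε ≤ 3 * rho d L * (L : ℝ) ^ 2) (j : ℕ) :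
    (160064 * (d : ℝ) * (d + 1) * (d + 4) * (L : ℝ) ^ 3) * radSum d L (j + 1) (ε / ((L : ℝ) ^ (j + 2)) ^ 2) ≤ rho d L / 2 := by
  have hL0 : (0 : ℝ) < L := by exact_mod_cast (show 0 < L by omega)
  have hL2 : (0 : ℝ) < (L : ℝ) ^ 2 := by positivity
  have hK0 : 0 ≤ 160064 * (d : ℝ) * (d + 1) * (d + 4) * (L : ℝ) ^ 3 := by positivity
  have hS := (radSum_family_le hL hε hε1 j).1
  calc (160064 * (d : ℝ) * (d + 1) * (d + 4) * (L : ℝ) ^ 3) * radSum d L (j + 1) (ε / ((L : ℝ) ^ (j + 2)) ^ 2)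
      ≤ (160064 * (d : ℝ) * (d + 1) * (d + 4) * (L : ℝ) ^ 3) * (8 / 3 * (ε / (L : ℝ) ^ 2)) := mul_le_mul_of_nonneg_left hS hK0
    _ = (16 * (160064 * (d : ℝ) * (d + 1) * (d + 4) * (L : ℝ) ^ 3) * ε) / (6 * (L : ℝ) ^ 2) := by field_simp; ring
    _ ≤ (3 * rho d L * (L : ℝ) ^ 2) / (6 * (L : ℝ) ^ 2) := div_le_div_of_nonneg_right hK (by positivity)
    _ = rho d L / 2 := by field_simp; ring

/-- **`hsmall` FROM ONE LINE**: `8√(3 card n)·(128(4d+5)(d+1)(d+4)·ε + (16∕3)·K·(ε∕L²)·√(L^d∕L²)) ≤ 1` gives, for every `j`,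
`8√(3 card n)·(2·((4d+5)∕10·DSum d L (j+2) x_j) + 2·K·radSum d L (j+1) x_j·√(L^d∕L²)) ≤ 1` at `x_j = ε(L^{j+2})^{−2}`. [folklore] -/
theorem hsmall_of_line {L : ℕ} (hL : 2 ≤ L) {ε : ℝ} (hε : 0 ≤ ε) (hε1 : 16 * C0 d * ε ≤ 3) (cn : ℝ)
    (hS : 8 * Real.sqrt (3 * cn)
        * (128 * (4 * (d : ℝ) + 5) * ((d : ℝ) + 1) * ((d : ℝ) + 4) * ε
            + 16 / 3 * (160064 * (d : ℝ) * (d + 1) * (d + 4) * (L : ℝ) ^ 3) * (ε / (L : ℝ) ^ 2)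
              * Real.sqrt ((L : ℝ) ^ d / (L : ℝ) ^ 2)) ≤ 1) (j : ℕ) :
    8 * Real.sqrt (3 * cn)
        * (2 * ((4 * d + 5) / 10 * DSum d L (j + 2) (ε / ((L : ℝ) ^ (j + 2)) ^ 2))
            + 2 * ((160064 * (d : ℝ) * (d + 1) * (d + 4) * (L : ℝ) ^ 3) * radSum d L (j + 1) (ε / ((L : ℝ) ^ (j + 2)) ^ 2))
              * Real.sqrt ((L : ℝ) ^ d / (L : ℝ) ^ 2)) ≤ 1 := by
  have hL0 : (0 : ℝ) < L := by exact_mod_cast (show 0 < L by omega)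
  have hK0 : 0 ≤ 160064 * (d : ℝ) * (d + 1) * (d + 4) * (L : ℝ) ^ 3 := by positivity
  have hD := DSum_family_le hL hε hε1 j
  have hR := (radSum_family_le hL hε hε1 j).1
  have hsq : 0 ≤ Real.sqrt ((L : ℝ) ^ d / (L : ℝ) ^ 2) := Real.sqrt_nonneg _
  have h1 : 2 * ((4 * d + 5) / 10 * DSum d L (j + 2) (ε / ((L : ℝ) ^ (j + 2)) ^ 2))
      ≤ 128 * (4 * (d : ℝ) + 5) * ((d : ℝ) + 1) * ((d : ℝ) + 4) * ε := by
    have h0 : (0 : ℝ) ≤ 2 * ((4 * d + 5) / 10) := by positivity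
    calc 2 * ((4 * d + 5) / 10 * DSum d L (j + 2) (ε / ((L : ℝ) ^ (j + 2)) ^ 2))
        = 2 * ((4 * d + 5) / 10) * DSum d L (j + 2) (ε / ((L : ℝ) ^ (j + 2)) ^ 2) := by ring
      _ ≤ 2 * ((4 * d + 5) / 10) * (640 * ((d : ℝ) + 1) * ((d : ℝ) + 4) * ε) := mul_le_mul_of_nonneg_left hD h0
      _ = 128 * (4 * (d : ℝ) + 5) * ((d : ℝ) + 1) * ((d : ℝ) + 4) * ε := by ring
  have h2 : 2 * ((160064 * (d : ℝ) * (d + 1) * (d + 4) * (L : ℝ) ^ 3) * radSum d L (j + 1) (ε / ((L : ℝ) ^ (j + 2)) ^ 2))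
        * Real.sqrt ((L : ℝ) ^ d / (L : ℝ) ^ 2)
      ≤ 16 / 3 * (160064 * (d : ℝ) * (d + 1) * (d + 4) * (L : ℝ) ^ 3) * (ε / (L : ℝ) ^ 2)
        * Real.sqrt ((L : ℝ) ^ d / (L : ℝ) ^ 2) := by
    refine mul_le_mul_of_nonneg_right ?_ hsq
    calc 2 * ((160064 * (d : ℝ) * (d + 1) * (d + 4) * (L : ℝ) ^ 3) * radSum d L (j + 1) (ε / ((L : ℝ) ^ (j + 2)) ^ 2))
        ≤ 2 * ((160064 * (d : ℝ) * (d + 1) * (d + 4) * (L : ℝ) ^ 3) * (8 / 3 * (ε / (L : ℝ) ^ 2))) :=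
          mul_le_mul_of_nonneg_left (mul_le_mul_of_nonneg_left hR hK0) (by norm_num)
      _ = _ := by ring
  have h8 : 0 ≤ 8 * Real.sqrt (3 * cn) := by positivity
  exact le_trans (mul_le_mul_of_nonneg_left (add_le_add h1 h2) h8) hS

/-- **`hls` FROM TWO LINES** (= `NE3ClassRadiusFamily.levelSmall_family` with `C₀` by name): `16·C₀·ε ≤ 3` and `2·twoLevelSmall d L·ε ≤ L²`
give `LevelSmall d L (j+1) (ε(L^{j+2})^{−2})` for every `j`. [folklore] -/
theorem hls_of_lines {L : ℕ} (hL : 2 ≤ L) {ε : ℝ} (hε : 0 ≤ ε) (hε1 : 16 * C0 d * ε ≤ 3)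
    (h2 : 2 * twoLevelSmall d L * ε ≤ (L : ℝ) ^ 2) (j : ℕ) : LevelSmall d L (j + 1) (ε / ((L : ℝ) ^ (j + 2)) ^ 2) := by
  have hC : C0 d = 14464 * ((d : ℝ) + 1) ^ 2 * ((d : ℝ) + 4) ^ 2 := by unfold C0; ring
  rw [hC] at hε1
  exact levelSmall_family (d := d) hL hε hε1 h2 j

/-! ## §3 (H∃)ᴱ from the existence of interior minimisers -/

variable {n : Type*} [Fintype n] [DecidableEq n] [Nonempty n]

/-- **(H∃)ᴱ FROM (8)∃ AND LEVEL-FREE LINES.**  Let `L ≥ 2`, `N ≥ 1`, `0 ≤ ε ≤ 1∕50` with the four level-free `ε`-lines `16·C₀·ε ≤ 3`,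
`2·twoLevelSmall d L·ε ≤ L²`, `16·K·ε ≤ 3·ρ·L²`, `8√(3 card n)·(128(4d+5)(d+1)(d+4)·ε + (16∕3)·K·(ε∕L²)·√(L^d∕L²)) ≤ 1`
(`K = 160064·d(d+1)(d+4)L³`, `ρ = √(L²∕L^d)`), and assume (8)∃: for every datum `V ∈ dom` and every level `k` SOME `k`-level constrained
minimiser over `sfClass d L N ε` is `SmallField U a` with `0 ≤ a < ε(L^k)^{−2}` ([Balaban1985Variational] Thm 1 (8) TYPE — a HYPOTHESIS,
not in the tree).  THEN (H∃)ᴱ: `∀ V ∈ dom, ∀ k, ∃ U, IsMinimiser … k V U ∧ Regular d L N ε (card n·g″ + 220·card n·d³ε³) k U`,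
`g″ = 624·d³ε²(1+(d+1)ε)² + 6768·#Plane²·d·card n·ε⁴ + 16d³ε²L²`.  No non-emptiness, no compactness, no `∀`-minimiser interiority. [folklore] -/
theorem hminE_of_interior_exists {L N : ℕ} (hL2 : 2 ≤ L) (hN : 1 ≤ N) {ε : ℝ} (hε0 : 0 ≤ ε) (hε : ε ≤ 1 / 50)
    (hε1 : 16 * C0 d * ε ≤ 3) (h2line : 2 * twoLevelSmall d L * ε ≤ (L : ℝ) ^ 2)
    (hK : 16 * (160064 * (d : ℝ) * (d + 1) * (d + 4) * (L : ℝ) ^ 3) * ε ≤ 3 * rho d L * (L : ℝ) ^ 2)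
    (hS : 8 * Real.sqrt (3 * Fintype.card n)
        * (128 * (4 * (d : ℝ) + 5) * ((d : ℝ) + 1) * ((d : ℝ) + 4) * ε
            + 16 / 3 * (160064 * (d : ℝ) * (d + 1) * (d + 4) * (L : ℝ) ^ 3) * (ε / (L : ℝ) ^ 2)
              * Real.sqrt ((L : ℝ) ^ d / (L : ℝ) ^ 2)) ≤ 1)
    {dom : Set (Site d → Fin d → (Matrix n n ℂ)ˣ)}
    (hint : ∀ V ∈ dom, ∀ k : ℕ, ∃ U : Site d → Fin d → (Matrix n n ℂ)ˣ, IsMinimiser d (sfClass d L N ε) L N k V U ∧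
      ∃ a : ℝ, 0 ≤ a ∧ a < ε / ((L : ℝ) ^ k) ^ 2 ∧ SmallField U a) :
    ∀ V ∈ dom, ∀ k : ℕ, ∃ U, IsMinimiser d (sfClass d L N ε) L N k V U ∧
      Regular d L N ε ((Fintype.card n : ℝ)
          * (624 * (d : ℝ) ^ 3 * ε ^ 2 * (1 + ((d : ℝ) + 1) * ε) ^ 2
              + 6768 * (Fintype.card (T4AveragingDeficitWall.Plane d) : ℝ) ^ 2 * d * Fintype.card n * ε ^ 4
              + 16 * (d : ℝ) ^ 3 * ε ^ 2 * (L : ℝ) ^ 2)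
        + 220 * (Fintype.card n : ℝ) * (d : ℝ) ^ 3 * ε ^ 3) k U := by
  have hL : 1 ≤ L := le_trans (by norm_num) hL2
  refine hminE_of_tension hL hN hε0 hε fun V hV k => ?_
  obtain ⟨U, hmin, a, ha0, haε, hUa⟩ := hint V hV k
  obtain ⟨B, hBF, hanti⟩ := exists_fluxForm U
  refine ⟨U, B, hmin, hBF, hanti, ?_⟩
  -- common nonnegative pieces of `g″`
  have hg1 : 0 ≤ 624 * (d : ℝ) ^ 3 * ε ^ 2 * (1 + ((d : ℝ) + 1) * ε) ^ 2 := by positivity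
  have hg2 : 0 ≤ 6768 * (Fintype.card (T4AveragingDeficitWall.Plane d) : ℝ) ^ 2 * d * Fintype.card n * ε ^ 4 := by positivity
  have hg3 : 0 ≤ 16 * (d : ℝ) ^ 3 * ε ^ 2 * (L : ℝ) ^ 2 := by positivity
  have hsc : 0 ≤ (N : ℝ) ^ d * ((L : ℝ) ^ k) ^ d / ((L : ℝ) ^ k) ^ 6 := by positivity
  have e : ∀ g : ℝ, g * (N : ℝ) ^ d * ((L : ℝ) ^ k) ^ d / ((L : ℝ) ^ k) ^ 6
      = g * ((N : ℝ) ^ d * ((L : ℝ) ^ k) ^ d / ((L : ℝ) ^ k) ^ 6) := fun g => by ring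
  rcases Nat.lt_or_ge k 2 with hk | hk
  · -- the two lowest levels: the trivial bound, interiority not used
    have h := tension_energy_le_low hL hε0 (by linarith) (by omega) hmin hBF hanti
    refine h.trans ?_
    rw [e, e]
    exact mul_le_mul_of_nonneg_right (by linarith) hsc
  · -- the interior levels `k = j + 2`: the interior minimiser supplied by (8)∃
    obtain ⟨j, rfl⟩ : ∃ j, k = j + 2 := ⟨k - 2, by omega⟩
    haveI : NeZero N := ⟨by omega⟩
    haveI : NeZero (L ^ (j + 2) * N) := ⟨(mul_pos (pow_pos (by omega) _) (by omega)).ne'⟩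
    have hx1 : ε / ((L : ℝ) ^ (j + 2)) ^ 2 ≤ ε :=
      div_le_self hε0 (one_le_pow₀ (one_le_pow₀ (by exact_mod_cast hL)))
    have ha4 : a ≤ 1 / 4 := by linarith
    have h := tension_energy_le_gprime hL2 hN j hmin ha0 ha4 haε hUa (hls_of_lines hL2 hε0 hε1 h2line j)
      (hKS_of_line hL2 hε0 hε1 hK j) (hsmall_of_line hL2 hε0 hε1 (Fintype.card n : ℝ) hS j) hBF hanti
    rw [Nat.mul_comm N]
    refine h.trans ?_
    rw [e, e]
    exact mul_le_mul_of_nonneg_right (by linarith) hsc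

/-! ## §4 `d = 4`: one numeric line -/

/-- `rho 4 L = 1∕L` (`L ≥ 1`). [folklore] -/
theorem rho_four {L : ℕ} (hL : 1 ≤ L) : rho 4 L = 1 / (L : ℝ) := by
  have hL0 : (0 : ℝ) < L := by exact_mod_cast (show 0 < L by omega)
  unfold rho
  have e : (L : ℝ) ^ 2 / (L : ℝ) ^ 4 = (1 / (L : ℝ)) ^ 2 := by field_simp
  rw [e, Real.sqrt_sq (by positivity)]

/-- `√(L⁴∕L²) = L` (`L ≥ 1`). [folklore] -/
theorem sqrt_pow_four_div_sq {L : ℕ} (hL : 1 ≤ L) : Real.sqrt ((L : ℝ) ^ 4 / (L : ℝ) ^ 2) = L := by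
  have hL0 : (0 : ℝ) < L := by exact_mod_cast (show 0 < L by omega)
  have e : (L : ℝ) ^ 4 / (L : ℝ) ^ 2 = (L : ℝ) ^ 2 := by field_simp
  rw [e, Real.sqrt_sq hL0.le]

/-- **THE `ε`-LINES AT `d = 4` FROM ONE**: `2·10⁹·L⁶·ε ≤ 1` (`L ≥ 2`, `0 ≤ ε`) implies `ε ≤ 1∕50`, `16·C₀·ε ≤ 3` (`C₀ = 23 142 400`),
`2·twoLevelSmall 4 L·ε ≤ L²` (`twoLevelSmall 4 L = 104 857 600·L⁸`), `512·5·8·L²·ε ≤ 1`, and the two numeric letters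
`409 763 840·L²ε ≤ 3` (`16·K = 409 763 840·L³`) and `107 520·ε + (409 763 840∕3)·L²ε ≤ 136 695 467·L⁶ε` of the `hKS` ∕ `hsmall` lines.
[folklore] -/
theorem lines_d4 {L : ℕ} (hL : 2 ≤ L) {ε : ℝ} (hε : 0 ≤ ε) (h : 2 * 10 ^ 9 * ((L : ℝ) ^ 6 * ε) ≤ 1) :
    ε ≤ 1 / 50 ∧ 16 * C0 4 * ε ≤ 3 ∧ 2 * twoLevelSmall 4 L * ε ≤ (L : ℝ) ^ 2 ∧
      512 * (4 + 1) * (4 + 4) * (L : ℝ) ^ 2 * ε ≤ 1 ∧ 409763840 * ((L : ℝ) ^ 2 * ε) ≤ 3 ∧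
      107520 * ε + 409763840 / 3 * ((L : ℝ) ^ 2 * ε) ≤ 136695467 * ((L : ℝ) ^ 6 * ε) := by
  have hL2 : (2 : ℝ) ≤ L := by exact_mod_cast hL
  have hLge1 : (1 : ℝ) ≤ L := by linarith
  have hpow2 : (L : ℝ) ^ 2 * ε ≤ (L : ℝ) ^ 6 * ε :=
    mul_le_mul_of_nonneg_right (pow_le_pow_right₀ hLge1 (by norm_num)) hε
  have hpow0 : ε ≤ (L : ℝ) ^ 6 * ε := by
    have := mul_le_mul_of_nonneg_right (one_le_pow₀ (n := 6) hLge1) hε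
    linarith
  have hL2ε : 0 ≤ (L : ℝ) ^ 2 * ε := by positivity
  refine ⟨by linarith, ?_, ?_, by linarith, by linarith, by linarith⟩
  · have hC : C0 4 = 23142400 := by unfold C0; norm_num
    rw [hC]; linarith
  · have hT : twoLevelSmall 4 L = 104857600 * (L : ℝ) ^ 8 := by unfold twoLevelSmall; norm_num
    rw [hT]
    have e : 2 * (104857600 * (L : ℝ) ^ 8) * ε = (L : ℝ) ^ 2 * (209715200 * ((L : ℝ) ^ 6 * ε)) := by ring
    rw [e]
    have h1 : 209715200 * ((L : ℝ) ^ 6 * ε) ≤ 1 := by linarith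
    have hL21 : (1 : ℝ) ≤ (L : ℝ) ^ 2 := one_le_pow₀ hLge1
    have := mul_le_mul_of_nonneg_left h1 (by positivity : 0 ≤ (L : ℝ) ^ 2)
    nlinarith

/-- **(H∃)ᴱ AT `d = 4` FROM (8)∃ AND ONE NUMERIC LINE** `2·10⁹·√(card n)·L⁶·ε ≤ 1` (`L ≥ 2`, `N ≥ 1`, `0 ≤ ε`): the energy-class hypothesis
`hminE` of `NE7Route1EndDockedEnergy.goodClause_summable_of_route1_docked_energy` with `b = ε`, `g = card n·g″ + 220·card n·4³·ε³`
(`ρ = 1∕L`, `√(L⁴∕L²) = L`, `8√3 < 14`, `14·136 695 467 < 2·10⁹`).  (8)∃ is a HYPOTHESIS (B11 Thm 1 type), asserted for no datum. [folklore] -/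
theorem hminE_of_interior_exists_d4 {L N : ℕ} (hL2 : 2 ≤ L) (hN : 1 ≤ N) {ε : ℝ} (hε0 : 0 ≤ ε)
    (hline : 2 * 10 ^ 9 * Real.sqrt (Fintype.card n) * (L : ℝ) ^ 6 * ε ≤ 1)
    {dom : Set (Site 4 → Fin 4 → (Matrix n n ℂ)ˣ)}
    (hint : ∀ V ∈ dom, ∀ k : ℕ, ∃ U : Site 4 → Fin 4 → (Matrix n n ℂ)ˣ, IsMinimiser 4 (sfClass 4 L N ε) L N k V U ∧
      ∃ a : ℝ, 0 ≤ a ∧ a < ε / ((L : ℝ) ^ k) ^ 2 ∧ SmallField U a) :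
    ∀ V ∈ dom, ∀ k : ℕ, ∃ U, IsMinimiser 4 (sfClass 4 L N ε) L N k V U ∧
      Regular 4 L N ε ((Fintype.card n : ℝ)
          * (624 * ((4 : ℕ) : ℝ) ^ 3 * ε ^ 2 * (1 + (((4 : ℕ) : ℝ) + 1) * ε) ^ 2
              + 6768 * (Fintype.card (T4AveragingDeficitWall.Plane 4) : ℝ) ^ 2 * (4 : ℕ) * Fintype.card n * ε ^ 4
              + 16 * ((4 : ℕ) : ℝ) ^ 3 * ε ^ 2 * (L : ℝ) ^ 2)
        + 220 * (Fintype.card n : ℝ) * ((4 : ℕ) : ℝ) ^ 3 * ε ^ 3) k U := by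
  have hL1 : 1 ≤ L := le_trans (by norm_num) hL2
  have hL0 : (0 : ℝ) < L := by exact_mod_cast (show 0 < L by omega)
  have hcn : (1 : ℝ) ≤ Fintype.card n := by exact_mod_cast Fintype.card_pos
  have hs1 : 1 ≤ Real.sqrt (Fintype.card n : ℝ) := by rw [← Real.sqrt_one]; exact Real.sqrt_le_sqrt hcn
  have hs0 : 0 ≤ Real.sqrt (Fintype.card n : ℝ) := Real.sqrt_nonneg _
  have hL6ε : 0 ≤ (L : ℝ) ^ 6 * ε := by positivity
  have h : 2 * 10 ^ 9 * ((L : ℝ) ^ 6 * ε) ≤ 1 := by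
    have h1 : (L : ℝ) ^ 6 * ε ≤ Real.sqrt (Fintype.card n : ℝ) * ((L : ℝ) ^ 6 * ε) := by
      have := mul_le_mul_of_nonneg_right hs1 hL6ε
      linarith
    calc 2 * 10 ^ 9 * ((L : ℝ) ^ 6 * ε) ≤ 2 * 10 ^ 9 * (Real.sqrt (Fintype.card n : ℝ) * ((L : ℝ) ^ 6 * ε)) :=
          mul_le_mul_of_nonneg_left h1 (by norm_num)
      _ = 2 * 10 ^ 9 * Real.sqrt (Fintype.card n) * (L : ℝ) ^ 6 * ε := by ring
      _ ≤ 1 := hline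
  obtain ⟨hε, hε1, h2, -, hKn, hSn⟩ := lines_d4 hL2 hε0 h
  refine hminE_of_interior_exists hL2 hN hε0 hε hε1 h2 ?_ ?_ hint
  · -- the `hKS` line: `16·K·ε = L·(409 763 840·L²ε) ≤ L·3 = 3·ρ·L²`
    rw [rho_four hL1]
    have key : (L : ℝ) * (409763840 * ((L : ℝ) ^ 2 * ε)) ≤ (L : ℝ) * 3 := mul_le_mul_of_nonneg_left hKn hL0.le
    have e2 : 3 * (1 / (L : ℝ)) * (L : ℝ) ^ 2 = (L : ℝ) * 3 := by field_simp
    rw [e2]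
    convert key using 1
    push_cast; ring
  · -- the `hsmall` line: `8√(3 card n)·(107 520·ε + (409 763 840∕3)·L²ε) ≤ 14√(card n)·136 695 467·L⁶ε < 1`
    rw [sqrt_pow_four_div_sq hL1]
    have h83 : 8 * Real.sqrt (3 * (Fintype.card n : ℝ)) ≤ 14 * Real.sqrt (Fintype.card n : ℝ) := by
      rw [Real.sqrt_mul (by norm_num)]
      have h3 : Real.sqrt 3 ≤ 7 / 4 := by
        rw [Real.sqrt_le_left (by norm_num)]; norm_num
      nlinarith
    have hin0 : 0 ≤ 107520 * ε + 409763840 / 3 * ((L : ℝ) ^ 2 * ε) := by positivity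
    have key : 8 * Real.sqrt (3 * (Fintype.card n : ℝ)) * (107520 * ε + 409763840 / 3 * ((L : ℝ) ^ 2 * ε)) ≤ 1 :=
      calc 8 * Real.sqrt (3 * (Fintype.card n : ℝ)) * (107520 * ε + 409763840 / 3 * ((L : ℝ) ^ 2 * ε))
          ≤ 14 * Real.sqrt (Fintype.card n : ℝ) * (136695467 * ((L : ℝ) ^ 6 * ε)) :=
            mul_le_mul h83 hSn hin0 (by positivity)
        _ = 1913736538 / (2 * 10 ^ 9) * (2 * 10 ^ 9 * Real.sqrt (Fintype.card n) * (L : ℝ) ^ 6 * ε) := by ring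
        _ ≤ 1913736538 / (2 * 10 ^ 9) * 1 := mul_le_mul_of_nonneg_left hline (by norm_num)
        _ ≤ 1 := by norm_num
    have hLne : (L : ℝ) ≠ 0 := hL0.ne'
    convert key using 2
    simp only [Nat.cast_ofNat]
    field_simp
    ring

end

end Summit.QuantumFields.BalabanUV.T4Continuum.NE7InteriorMinimiserDocking
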